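import Literature.Probability.Percolation.ArmSeparationLandingGlue
import Literature.Probability.Percolation.ArmSeparationExtArm
import Literature.Probability.Percolation.ArmSeparationSepInit
import HarnessLib

/-!
# Gluing an outer exit run to the landing zone of `∂Λ_N`

Topic: Probability / Percolation; family `crit-perc`. A brick of the discharge of
`Literature.Probability.Percolation.Nolin2008_twoArm_separation` (Nolin 2008, Thm. 11
[arXiv 0711.4948: Thm. 10]; `ArmSeparation.lean`), landing of the EXTERNAL extremities (mirror
of `ArmSeparationLandingGlue.lean`, which lands the internal ones). The open arm, rerouted along a
ring road of radius `r` outside `Λ_{2M}`, leaves the ring on its side `0` through an exit run of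
vertical pieces about the row `t`; four explicit open crossings then land it in the landing zone
of the right side of `∂Λ_N` with its outer free space crossed (the shapes (ii)–(v) of
`sepInitArm`, `ArmSeparationSepInit.lean`):

* `extE2 N r e t W` — the approach tube `[r - e - 1, N - 1] × [t, t + r/64]`, crossed
  horizontally; `extE3 N H` — the connector band `[N - N/8, N - 1] × [-N/2 - N/64, t + r/64]`,
  crossed vertically; `extE4 N`, `extE5 N` — the crossing of the fence line and the thinned outer
  free space at the landing site `z = (N, -N/2)`, as in `sepInitArm`.
* `ext_landing_glue` — **the deterministic gluing**: an open path from a site of norm `n` to the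
  entry piece of the ring arc, the open crossings of the arc (containing the exit run), and the
  four crossings give `χ ∈ extOpenArm n N`.

## References

* P. Nolin, *Near-critical percolation in two dimensions*, Electron. J. Probab. 13 (2008), §4.2
  Def. 6–8, §4.3 Prop. 12 (proof), §4.4 [arXiv 0711.4948: Def. 6–8, Prop. 11, Thm. 10]. [Nolin2008]
-/

noncomputable section

open Set

namespace Literature.Probability.Percolation

open LatticeModels Tube

/-! ### The four landing crossings -/

/-- **The approach tube** `[r - e - 1, r - e - 1 + W] × [t, t + r/64]` (with `r - e - 1 + W = N - 1`),
crossed horizontally. [cite: Nolin2008, §4.3 Prop. 12 (proof) (arXiv 0711.4948: Prop. 11)] -/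
def extE2 (r e : ℕ) (t : ℤ) (W : ℕ) : Set (SiteConfig (Site 2)) := triHCross ((r : ℤ) - e - 1) t W (r / 64)

/-- **The connector band** `[N - N/8, N - 1] × [-N/2 - N/64, -N/2 - N/64 + H]`, crossed
vertically. [cite: Nolin2008, §4.3 Prop. 12 (proof) (arXiv 0711.4948: Prop. 11)] -/
def extE3 (N H : ℕ) : Set (SiteConfig (Site 2)) :=
  triVCross ((N : ℤ) - (N / 8 : ℕ)) (-((N / 2 : ℕ) : ℤ) - (N / 64 : ℕ)) (N / 8 - 1) H

/-- **The crossing of the fence line** `[N - N/8, N + N/8 - 1] × [-N/2 - N/64 + 1, -N/2]`, crossed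
horizontally. [cite: Nolin2008, §4.2 Def. 6 (arXiv 0711.4948)] -/
def extE4 (N : ℕ) : Set (SiteConfig (Site 2)) :=
  triHCross ((N : ℤ) - (N / 8 : ℕ)) (-((N / 2 : ℕ) : ℤ) - (N / 64 : ℕ) + 1) (2 * (N / 8) - 1) (N / 64 - 1)

/-- **The thinned outer free space** `[N + 2, N + N/8 - 1] × [-N/2 - N/64, -N/2 + N/64]`, crossed
vertically. [cite: Nolin2008, §4.2 Def. 6 (arXiv 0711.4948)] -/
def extE5 (N : ℕ) : Set (SiteConfig (Site 2)) :=
  triVCross ((N : ℤ) + 2) (-((N / 2 : ℕ) : ℤ) - (N / 64 : ℕ)) (N / 8 - 3) (2 * (N / 64))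

/-- The four landing events are increasing. [folklore] -/
theorem isUpperSet_extE (N r e : ℕ) (t : ℤ) (W H : ℕ) :
    IsUpperSet (extE2 r e t W) ∧ IsUpperSet (extE3 N H) ∧ IsUpperSet (extE4 N) ∧ IsUpperSet (extE5 N) :=
  ⟨isUpperSet_triHCross _ _ _ _, isUpperSet_triVCross _ _ _ _, isUpperSet_triHCross _ _ _ _, isUpperSet_triVCross _ _ _ _⟩

/-- The approach tube lies in the annulus `{n ≤ |v| ≤ N}` (`n + e + 1 ≤ r`, `r - e - 1 + W ≤ N`,
`-N/2 ≤ t`, `t + r/64 ≤ 0`). [folklore] -/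
theorem extE2Strip_subset {n N r e W : ℕ} {t : ℤ} (hnr : (n : ℤ) + e + 1 ≤ r) (hW : (r : ℤ) - e - 1 + W ≤ N)
    (htlo : -((N / 2 : ℕ) : ℤ) ≤ t) (hthi : t + (r / 64 : ℕ) ≤ 0) :
    triStrip ((r : ℤ) - e - 1) t W (r / 64) ⊆ triAnnulusSet n N := by
  intro v hv
  rw [mem_triStrip] at hv
  exact ⟨le_triNorm_iff_lin.2 (Or.inl (by omega)), triNorm_le_iff_lin.2 (by omega)⟩

/-- The connector band lies in the annulus (`2n ≤ N`, `-N/2 - N/64 + H ≤ 0`). [folklore] -/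
theorem extE3Strip_subset {n N H : ℕ} (hN : 64 ≤ N) (hnN : 2 * n ≤ N) (hH : -((N / 2 : ℕ) : ℤ) - (N / 64 : ℕ) + H ≤ 0) :
    triStrip ((N : ℤ) - (N / 8 : ℕ)) (-((N / 2 : ℕ) : ℤ) - (N / 64 : ℕ)) (N / 8 - 1) H ⊆ triAnnulusSet n N := by
  intro v hv
  rw [mem_triStrip] at hv
  have e : ((N / 8 - 1 : ℕ) : ℤ) = (N / 8 : ℕ) - 1 := by omega
  rw [e] at hv
  exact ⟨le_triNorm_iff_lin.2 (Or.inl (by omega)), triNorm_le_iff_lin.2 (by omega)⟩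

/-- The crossing of the fence line lies in the arm region: inside `Λ_N` in the annulus, beyond in
the outer attaching ball (`64 ≤ N`, `2n ≤ N`). [cite: Nolin2008, §4.2 Def. 6 (arXiv 0711.4948)] -/
theorem extE4Strip_subset {n N : ℕ} (hN : 64 ≤ N) (hnN : 2 * n ≤ N) :
    triStrip ((N : ℤ) - (N / 8 : ℕ)) (-((N / 2 : ℕ) : ℤ) - (N / 64 : ℕ) + 1) (2 * (N / 8) - 1) (N / 64 - 1) ⊆
      triAnnulusSet n N ∪ triOpenBall ![(N : ℤ), -((N / 2 : ℕ) : ℤ)] (N / 8) := by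
  intro v hv
  rw [mem_triStrip] at hv
  have e : ((2 * (N / 8) - 1 : ℕ) : ℤ) = 2 * (N / 8 : ℕ) - 1 := by omega
  have e' : ((N / 64 - 1 : ℕ) : ℤ) = (N / 64 : ℕ) - 1 := by omega
  rw [e, e'] at hv
  rcases le_or_gt (v 0) (N : ℤ) with h0 | h0
  · refine Or.inl ⟨le_triNorm_iff_lin.2 (Or.inl (by omega)), triNorm_le_iff_lin.2 ?_⟩
    omega
  · refine Or.inr ?_
    rw [mem_triOpenBall, triNorm_lt_iff_lin]
    simp only [Pi.sub_apply, site_mk_apply_zero, site_mk_apply_one]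
    omega

/-! ### The gluing -/

/-- **Gluing the outer exit run to the landing zone** (deterministic): from (a) an open path of
`R₁ ⊆ {n ≤ |v| ≤ N} ∪ S̊_{N/8}(z)` from a site `a` of norm `n` to the entry crossing of the ring
arc, (b) open crossings of the tubes of the arc `E :: L` (a chain, all inside the annulus)
containing the exit run `V_{j₀}, …, V_{j₀+d}` of the side `0` of the ring of radius `r`, whose rows
cover `[t, t + r/64]`, and (c) open crossings of `extE2`, `extE3`, `extE4`, `extE5`, the
configuration lies in `extOpenArm n N`, landing at `z = (N, -N/2)`. [cite: Nolin2008, §4.3 Prop. 12 (proof) and §4.4 (arXiv 0711.4948: Prop. 11, Thm. 10, external extremities)] -/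
theorem ext_landing_glue {n N : ℕ} {χ : SiteConfig (Site 2)} {a : Site 2} (ha : triNorm a = n)
    {E : Tube} {L : List Tube} (hch : List.IsChain Crosses (E :: L)) {X Y : Tube → Site 2}
    (hXY : ∀ T ∈ E :: L, T.IsCrossing χ (X T) (Y T)) (hLreg : ∀ T ∈ E :: L, T.box ⊆ triAnnulusSet n N)
    {R₁ : Set (Site 2)} (hR₁ : R₁ ⊆ triAnnulusSet n N ∪ triOpenBall ![(N : ℤ), -((N / 2 : ℕ) : ℤ)] (N / 8))
    {Te : Tube} (hTe : Te ∈ E :: L) (P₁ : PathIn triGraph (R₁ ∩ χ) a (X Te))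
    {r e s j₀ d : ℕ} (hSL : ∀ T ∈ vchunks r (-(r : ℤ)) e s j₀ (d + 1), T ∈ E :: L)
    {t : ℤ} (hlo : -(r : ℤ) + j₀ * s - e ≤ t) (hhi : t + (r / 64 : ℕ) ≤ -(r : ℤ) + (j₀ + d) * s - e)
    {W H : ℕ} (hW : (r : ℤ) - e - 1 + W = N - 1) (hH : -((N / 2 : ℕ) : ℤ) - (N / 64 : ℕ) + H = t + (r / 64 : ℕ))
    (h2 : χ ∈ extE2 r e t W) (h3 : χ ∈ extE3 N H) (h4 : χ ∈ extE4 N) (h5 : χ ∈ extE5 N)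
    (hN : 128 ≤ N) (hnN : 2 * n ≤ N) (hnr : (n : ℤ) + e + 1 ≤ r) (hrN : (r : ℤ) ≤ (N : ℤ) - (N / 8 : ℕ))
    (hreN : (r : ℤ) + e + 1 ≤ N) (htlo : -((N / 2 : ℕ) : ℤ) ≤ t) (hthi : t + (r / 64 : ℕ) ≤ 0) :
    χ ∈ extOpenArm n N := by
  set z : Site 2 := ![(N : ℤ), -((N / 2 : ℕ) : ℤ)] with hz
  have hz1 : z 1 = -((N / 2 : ℕ) : ℤ) := site_mk_apply_one _ _
  have e3 : ((N / 8 - 1 : ℕ) : ℤ) = (N / 8 : ℕ) - 1 := by omega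
  have e4 : ((2 * (N / 8) - 1 : ℕ) : ℤ) = 2 * (N / 8 : ℕ) - 1 := by omega
  have e4' : ((N / 64 - 1 : ℕ) : ℤ) = (N / 64 : ℕ) - 1 := by omega
  have e5 : ((N / 8 - 3 : ℕ) : ℤ) = (N / 8 : ℕ) - 3 := by omega
  obtain ⟨hl, hr, hhl, hhr, P2⟩ := h2
  obtain ⟨b₃, t₃, hb₃, ht₃, P3⟩ := h3
  obtain ⟨a₄, e₄, ha₄, he₄, P4⟩ := h4
  obtain ⟨b₅, t₅, hb₅, ht₅, P5⟩ := h5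
  have hhr' : hr 0 = (N : ℤ) - 1 := hhr.trans hW
  rw [e4] at he₄
  simp only [Nat.cast_mul, Nat.cast_ofNat] at ht₅
  -- (1) the outer attaching site `u'`: the crossing of the fence line meets the free-space crossing
  obtain ⟨S4, hS4, P4', T4⟩ := P4.exists_support
  obtain ⟨S5, hS5, P5', T5⟩ := P5.exists_support
  obtain ⟨u', huS4, huS5⟩ := exists_mem_of_cross (L := (N : ℤ) + 2) (R := (N : ℤ) + (N / 8 : ℕ) - 1)
    (B := -((N / 2 : ℕ) : ℤ) - (N / 64 : ℕ)) (T := -((N / 2 : ℕ) : ℤ) + (N / 64 : ℕ)) (by omega) (by omega)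
    P4' (by omega) (by omega)
    (fun v hv _ _ => by have h := (hS4 hv).1; rw [mem_triStrip, e4, e4'] at h; omega)
    P5' hb₅.le (by omega)
    (fun v hv _ _ => by have h := (hS5 hv).1; rw [mem_triStrip, e5] at h; omega)
  have hS5F : S5 ⊆ sepOuterFence N z ∩ χ := fun v hv => ⟨sepInitArmFence_subset_sepOuterFence (by omega) (hS5 hv).1, (hS5 hv).2⟩
  have hOut : OpenVCrossThrough (sepOuterFence N z) (z 1 - (N / 64 : ℕ)) (z 1 + (N / 64 : ℕ)) χ u' :=
    ⟨b₅, t₅, by rw [hz1, hb₅], by rw [hz1, ht₅]; ring, (T5 u' huS5).mono hS5F,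
      ((T5 u' huS5).symm.trans (T5 t₅ P5'.right_mem)).mono hS5F⟩
  -- (2) the exit run, read with the prescribed crossings, meets the approach tube
  obtain ⟨SH, hSH, P2', TH⟩ := P2.exists_support
  have hSHb : ∀ w ∈ SH, t ≤ w 1 ∧ w 1 ≤ t + (r / 64 : ℕ) := fun w hw => by
    have := (hSH hw).1; rw [mem_triStrip] at this; omega
  obtain ⟨L₀, hL₀⟩ := vchunks_eq_cons (r : ℤ) (-(r : ℤ)) e s j₀ d
  have hchSL : List.IsChain Crosses (vPiece r (-(r : ℤ)) e s j₀ :: L₀) := hL₀ ▸ isChain_vchunks _ _ e s j₀ (d + 1)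
  have hmemSL : ∀ T ∈ vPiece r (-(r : ℤ)) e s j₀ :: L₀, T ∈ vchunks r (-(r : ℤ)) e s j₀ (d + 1) := fun T hT => hL₀ ▸ hT
  have runs := chain_paths' X Y (vPiece r (-(r : ℤ)) e s j₀) L₀ hchSL (fun T hT => hXY T (hSL T (hmemSL T hT)))
  have hlast : vPiece r (-(r : ℤ)) e s (j₀ + d) ∈ vPiece r (-(r : ℤ)) e s j₀ :: L₀ := by
    rw [← hL₀]; exact List.mem_of_mem_getLast? (by rw [getLast?_vchunks]; rfl)
  have PV := runs _ hlast
  obtain ⟨SV, hSV, PV', TV⟩ := PV.exists_support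
  have hX0 : X (vPiece r (-(r : ℤ)) e s j₀) 1 = -(r : ℤ) + j₀ * s - e := by
    have := (hXY _ (hSL _ (hmemSL _ List.mem_cons_self))).1
    exact this.1.trans (by simp only [vPiece])
  have hX1 : X (vPiece r (-(r : ℤ)) e s (j₀ + d)) 1 = -(r : ℤ) + (j₀ + d) * s - e := by
    have := (hXY _ (hSL _ (hmemSL _ hlast))).1
    exact this.1.trans (by simp only [vPiece, Nat.cast_add])
  have hSVb : ∀ w ∈ SV, (r : ℤ) - e ≤ w 0 ∧ w 0 ≤ (r : ℤ) + e := fun w hw => by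
    obtain ⟨⟨T, hT, hwT⟩, -⟩ := hSV hw
    have := bounds_of_mem_vchunks (r : ℤ) (-(r : ℤ)) e s (hmemSL T hT) hwT
    exact ⟨this.1, this.2.1⟩
  obtain ⟨v, hvH, hvV⟩ := exists_mem_of_cross (L := (r : ℤ) - e) (R := (r : ℤ) + e) (B := t) (T := t + (r / 64 : ℕ))
    (by omega) (by omega) P2' (by omega) (by rw [hhr']; omega) (fun w hw _ _ => hSHb w hw)
    PV' (by rw [hX0]; exact hlo) (by rw [hX1]; exact hhi) (fun w hw _ _ => hSVb w hw)
  -- (3) along the arc from the entry tube to the exit run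
  have PA := (chain_paths' X Y E L hch hXY Te hTe).symm.trans (chain_paths' X Y E L hch hXY _ (hSL _ (hmemSL _ List.mem_cons_self)))
  -- (4) relays: approach tube / connector band / fence line
  have Q2 := PathIn.relay (L := (N : ℤ) - (N / 8 : ℕ)) (R := (N : ℤ) - 1)
    (B := -((N / 2 : ℕ) : ℤ) - (N / 64 : ℕ)) (T := t + (r / 64 : ℕ)) (by omega) (by omega)
    P2 (by omega) hhr'.ge (fun w hw _ _ => by rw [mem_triStrip] at hw; omega)
    P3 hb₃.le (by omega) (fun w hw _ _ => by rw [mem_triStrip, e3] at hw; omega)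
  have Q4 := PathIn.relay (L := (N : ℤ) - (N / 8 : ℕ)) (R := (N : ℤ) - 1)
    (B := -((N / 2 : ℕ) : ℤ) - (N / 64 : ℕ)) (T := t + (r / 64 : ℕ)) (by omega) (by omega)
    P4 ha₄.le (by omega) (fun w hw _ _ => by rw [mem_triStrip, e4, e4'] at hw; omega)
    P3 hb₃.le (by omega) (fun w hw _ _ => by rw [mem_triStrip, e3] at hw; omega)
  -- (5) regions
  set R : Set (Site 2) := triAnnulusSet n N ∪ triOpenBall z (N / 8) with hR
  have hann : triAnnulusSet n N ⊆ R := fun w hw => Or.inl hw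
  have R2 := extE2Strip_subset (N := N) (W := W) hnr (by omega) htlo hthi
  have R3 := extE3Strip_subset (H := H) (by omega) hnN (by omega)
  have R4 := extE4Strip_subset (n := n) (by omega) hnN
  have hHreg : SH ⊆ R ∩ χ := fun w hw => ⟨hann (R2 (hSH hw).1), (hSH hw).2⟩
  have hVreg : SV ⊆ R ∩ χ := fun w hw => by
    obtain ⟨⟨T, hT, hwT⟩, hwχ⟩ := hSV hw
    exact ⟨hann (hLreg T (hSL T (hmemSL T hT)) hwT), hwχ⟩
  have hAreg : boxAll (E :: L) ∩ χ ⊆ R ∩ χ := by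
    rintro w ⟨⟨T, hT, hwT⟩, hwχ⟩; exact ⟨hann (hLreg T hT hwT), hwχ⟩
  have W0 : PathIn triGraph (R ∩ χ) a (X Te) := P₁.mono fun w hw => ⟨hR₁ hw.1, hw.2⟩
  have W1 : PathIn triGraph (R ∩ χ) (X Te) (X (vPiece r (-(r : ℤ)) e s j₀)) := PA.mono hAreg
  have W2 : PathIn triGraph (R ∩ χ) (X (vPiece r (-(r : ℤ)) e s j₀)) v := (TV v hvV).mono hVreg
  have W3 : PathIn triGraph (R ∩ χ) v hl := (TH v hvH).symm.mono hHreg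
  have W4 : PathIn triGraph (R ∩ χ) hl b₃ := by
    refine Q2.mono ?_
    rintro w ⟨hw | hw, hwχ⟩
    exacts [⟨hann (R2 hw), hwχ⟩, ⟨hann (R3 hw), hwχ⟩]
  have W5 : PathIn triGraph (R ∩ χ) b₃ a₄ := by
    refine Q4.symm.mono ?_
    rintro w ⟨hw | hw, hwχ⟩
    exacts [⟨R4 hw, hwχ⟩, ⟨hann (R3 hw), hwχ⟩]
  have W6 : PathIn triGraph (R ∩ χ) a₄ u' := (T4 u' huS4).mono fun w hw => ⟨R4 (hS4 hw).1, (hS4 hw).2⟩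
  exact ⟨z, u', a, mk_mem_sepLanding N, ha, hOut, (((((W0.trans W1).trans W2).trans W3).trans W4).trans W5).trans W6⟩

end Literature.Probability.Percolation
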